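import Summits.HubbardSuperconductivity.HubbardSuperconductivity.Theorems.NodalDiracTwistTwistCalibrationBdGBondFourier

/-!
# Route `NodalDiracTwist` — support `TwistCalibrationBdG`: Lieb's transformation and the Nambu blocks

Second helper file for stmt-HubbardSuperconductivity-1625: Lieb's partial particle–hole
transformation `W = partialParticleHole D↓` (`c_{x↓} ↦ c†_{x↓}`, tree) on the Bloch modes
(`W c_{k↑} Wᴴ = c_{k↑}`, `W c_{k↓} Wᴴ = c†_{-k↓}`, `W n_{k↓} Wᴴ = 1 - n_{-k↓}`,
`W c_{k↑}c_{-k↓} Wᴴ = -c†_{k↓}c_{k↑}`) and the resulting block form of the `U = 0` sourced family: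
**`W H(φ) Wᴴ = Σ_k Q_k(ξ_k, h ĝ_k) + (Σ_k ξ_k)·1`** (`partialParticleHole_conj_sourcedSpinTwistedHubbardTorus`),
`Q_k = nambuQuad`, `ξ_k = twistXi`, `ĝ_k = twistPairSymbol`.

Sources: Lieb, PRL 62 (1989) 1201, proof of Thm 2; Bach–Lieb–Solovej, J. Stat. Phys. 76 (1994) 3, §2;
de Gennes (1966) Ch. 5. No definitions.
-/

-- the mandated namespace `Summit.<Summit>.<Problem>.Theorems` repeats `HubbardSuperconductivity`
-- (single-problem summit, D-0017), which the `dupNamespace` linter flags on every declaration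
set_option linter.dupNamespace false

namespace Summit.HubbardSuperconductivity.HubbardSuperconductivity.Theorems.NodalDiracTwist

open Matrix Finset Literature.Probability.LatticeModels Literature.MathematicalPhysics.QuantumLattice
open scoped ComplexConjugate

variable {d L : ℕ} [NeZero L]

/-! ### Lieb's partial particle–hole transformation on the Bloch modes -/

section PH

/-- Lieb's partial particle–hole transformation on the spin-down orbitals of the fermionic torus
(local notation). -/
local notation "𝓦" => partialParticleHole (spinDownOrbitals : Finset (Orb (FermionTorus d L)))

/-- The same in dimension `2` (local notation). -/
local notation "𝓦₂" => partialParticleHole (spinDownOrbitals : Finset (Orb (FermionTorus 2 L)))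

omit [NeZero L] in
/-- `(x, ↑) ∉ D↓`. [folklore] -/
theorem orb_zero_not_mem_spinDownOrbitals (x : FermionTorus d L) :
    orb x 0 ∉ (spinDownOrbitals : Finset (Orb (FermionTorus d L))) := by
  rw [orb_mem_spinDownOrbitals_iff]; exact Fin.zero_ne_one

omit [NeZero L] in
/-- `(x, ↓) ∈ D↓`. [folklore] -/
theorem orb_one_mem_spinDownOrbitals (x : FermionTorus d L) :
    orb x 1 ∈ (spinDownOrbitals : Finset (Orb (FermionTorus d L))) := by
  rw [orb_mem_spinDownOrbitals_iff]

/-- `W c_{k↑} Wᴴ = c_{k↑}`. [folklore] -/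
theorem partialParticleHole_conj_momentumAnnihilation_up (k : TorusSite d L) :
    𝓦 * momentumAnnihilation k 0 * 𝓦ᴴ = momentumAnnihilation k 0 := by
  unfold momentumAnnihilation
  rw [partialParticleHole_conj_sum]
  refine Finset.sum_congr rfl fun x _ => ?_
  rw [partialParticleHole_conj_smul,
    partialParticleHole_conj_annihilation_of_not_mem (orb_zero_not_mem_spinDownOrbitals x)]

/-- `W c_{k↓} Wᴴ = c†_{-k↓}`: a spin-down Bloch annihilator becomes the creator of the opposite
momentum. [folklore] -/
theorem partialParticleHole_conj_momentumAnnihilation_down (k : TorusSite d L) :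
    𝓦 * momentumAnnihilation k 1 * 𝓦ᴴ = momentumCreation (-k) 1 := by
  unfold momentumAnnihilation
  rw [partialParticleHole_conj_sum, momentumCreation_eq_sum]
  refine Finset.sum_congr rfl fun x _ => ?_
  rw [partialParticleHole_conj_smul,
    partialParticleHole_conj_annihilation_of_mem (orb_one_mem_spinDownOrbitals x), torusChar_neg_left]

/-- `W c†_{k↑} Wᴴ = c†_{k↑}`. [folklore] -/
theorem partialParticleHole_conj_momentumCreation_up (k : TorusSite d L) :
    𝓦 * momentumCreation k 0 * 𝓦ᴴ = momentumCreation k 0 := by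
  have h := congrArg conjTranspose (partialParticleHole_conj_momentumAnnihilation_up (L := L) k)
  simpa only [conjTranspose_mul, conjTranspose_conjTranspose, momentumAnnihilation_conjTranspose,
    Matrix.mul_assoc] using h

/-- `W c†_{k↓} Wᴴ = c_{-k↓}`. [folklore] -/
theorem partialParticleHole_conj_momentumCreation_down (k : TorusSite d L) :
    𝓦 * momentumCreation k 1 * 𝓦ᴴ = momentumAnnihilation (-k) 1 := by
  have h := congrArg conjTranspose (partialParticleHole_conj_momentumAnnihilation_down (L := L) k)
  simpa only [conjTranspose_mul, conjTranspose_conjTranspose, momentumAnnihilation_conjTranspose,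
    momentumCreation_conjTranspose, Matrix.mul_assoc] using h

/-- `W n_{k↑} Wᴴ = n_{k↑}`. [folklore] -/
theorem partialParticleHole_conj_momentumNumber_up (k : TorusSite d L) :
    𝓦 * momentumNumber k 0 * 𝓦ᴴ = momentumNumber k 0 := by
  rw [momentumNumber, partialParticleHole_conj_mul, partialParticleHole_conj_momentumCreation_up,
    partialParticleHole_conj_momentumAnnihilation_up]

/-- `W n_{k↓} Wᴴ = 1 - n_{-k↓}`. [folklore] -/
theorem partialParticleHole_conj_momentumNumber_down (k : TorusSite d L) :
    𝓦 * momentumNumber k 1 * 𝓦ᴴ = 1 - momentumNumber (-k) 1 := by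
  rw [momentumNumber, partialParticleHole_conj_mul, partialParticleHole_conj_momentumCreation_down,
    partialParticleHole_conj_momentumAnnihilation_down, momentumAnnihilation_mul_momentumCreation,
    if_pos ⟨rfl, rfl⟩, momentumNumber]

/-- `W (c_{k↑} c_{-k↓}) Wᴴ = c_{k↑} c†_{k↓} = -c†_{k↓} c_{k↑}`: the Cooper-pair annihilator becomes a
spin flip at fixed momentum. [folklore] -/
theorem partialParticleHole_conj_pairAnnihilator (k : TorusSite d L) :
    𝓦 * (momentumAnnihilation k 0 * momentumAnnihilation (-k) 1) * 𝓦ᴴ =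
      -(momentumCreation k 1 * momentumAnnihilation k 0) := by
  rw [partialParticleHole_conj_mul, partialParticleHole_conj_momentumAnnihilation_up,
    partialParticleHole_conj_momentumAnnihilation_down, neg_neg,
    momentumAnnihilation_mul_momentumCreation, if_neg (fun h => Fin.zero_ne_one h.2), zero_sub]

/-! ### The sourced spin-twisted family at `U = 0` after the transformation -/

/-- `cos(p_{-k,μ} - θ) = cos(p_{k,μ} + θ)` (`χ_{-k} = conj χ_k`). [folklore] -/
theorem cos_latticeMomentum_neg_sub (k : TorusSite d L) (μ : Fin d) (θ : ℝ) :
    Real.cos (latticeMomentum L (-k) μ - θ) = Real.cos (latticeMomentum L k μ + θ) := by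
  have h1 := exp_mul_torusChar_single_add_conj (L := L) (-k) μ (-θ)
  have h2 := exp_mul_torusChar_single_add_conj (L := L) k μ θ
  rw [torusChar_neg_left, Complex.conj_conj, Complex.ofReal_neg, mul_neg, neg_neg, add_comm,
    h2, ← sub_eq_add_neg] at h1
  have h3 := Complex.ofReal_injective h1
  linarith

/-- The spin-down twisted band at `-k` is the spin-up band at `k`: `t_↓(-k, φ) = t_↑(k, φ)`.
[folklore] -/
theorem twistHopSymbol_neg_one (φ : Fin d → ℝ) (k : TorusSite d L) :
    twistHopSymbol L φ (-k) 1 = twistHopSymbol L φ k 0 := by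
  simp only [twistHopSymbol, Fin.val_one, pow_one, neg_mul, one_mul, Fin.val_zero, pow_zero,
    neg_div, ← sub_eq_add_neg, cos_latticeMomentum_neg_sub]

/-- The `U = 0` sourced family is `-T(φ) - μ₀ N - h(P_φ + P_φᴴ)` in momentum space. [folklore] -/
theorem sourcedSpinTwistedHubbardTorus_zero_eq (μ₀ h : ℝ) (φ : Fin 2 → ℝ) :
    sourcedSpinTwistedHubbardTorus L 0 μ₀ h φ =
      -(∑ k : TorusSite 2 L, ∑ σ : Fin 2, ((twistHopSymbol L φ k σ : ℝ) : ℂ) • momentumNumber k σ) -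
      (μ₀ : ℂ) • (∑ k : TorusSite 2 L, ∑ σ : Fin 2, momentumNumber k σ) -
      (h : ℂ) • ((∑ k : TorusSite 2 L, ((twistPairSymbol L φ k : ℝ) : ℂ) •
          (momentumAnnihilation k 0 * momentumAnnihilation (-k) 1)) +
        (∑ k : TorusSite 2 L, ((twistPairSymbol L φ k : ℝ) : ℂ) •
          (momentumAnnihilation k 0 * momentumAnnihilation (-k) 1))ᴴ) := by
  rw [sourcedSpinTwistedHubbardTorus, spinTwistedHubbardTorus, spinTwistedHopping_eq_sum_momentumNumber,
    totalNumber_eq_sum_momentumNumber, twistedDWavePairField_eq_sum, Complex.ofReal_zero, zero_smul,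
    add_zero]

/-- Reindexing a momentum sum by `k ↦ -k`. [folklore] -/
theorem sum_neg_index {M : Type*} [AddCommMonoid M] (f : TorusSite d L → M) :
    ∑ k, f (-k) = ∑ k, f k :=
  Equiv.sum_comp (Equiv.neg (TorusSite d L)) f

/-- **The `U = 0` sourced spin-twisted family after Lieb's transformation** is a sum of Nambu blocks
plus a constant: `W H(φ) Wᴴ = Σ_k Q_k(ξ_k, h ĝ_k) + (Σ_k ξ_k)·1`. de Gennes (1966) Ch. 5;
Bach–Lieb–Solovej (1994) §2. [folklore] -/
theorem partialParticleHole_conj_sourcedSpinTwistedHubbardTorus (μ₀ h : ℝ) (φ : Fin 2 → ℝ) :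
    𝓦₂ * sourcedSpinTwistedHubbardTorus L 0 μ₀ h φ * 𝓦₂ᴴ =
      ∑ k : TorusSite 2 L, nambuQuad L k (twistXi L μ₀ φ k) (h * twistPairSymbol L φ k) +
        ((∑ k : TorusSite 2 L, twistXi L μ₀ φ k : ℝ) : ℂ) •
          (1 : Matrix (Finset (Orb (FermionTorus 2 L))) (Finset (Orb (FermionTorus 2 L))) ℂ) := by
  -- the four conjugated pieces
  have p1 : 𝓦₂ * (∑ k : TorusSite 2 L, ∑ σ : Fin 2,
      ((twistHopSymbol L φ k σ : ℝ) : ℂ) • momentumNumber k σ) * 𝓦₂ᴴ =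
      ∑ k : TorusSite 2 L, (((twistHopSymbol L φ k 0 : ℝ) : ℂ) • momentumNumber k 0 +
        ((twistHopSymbol L φ k 1 : ℝ) : ℂ) • (1 - momentumNumber (-k) 1)) := by
    rw [partialParticleHole_conj_sum]
    refine Finset.sum_congr rfl fun k _ => ?_
    rw [Fin.sum_univ_two, Matrix.mul_add, Matrix.add_mul, partialParticleHole_conj_smul,
      partialParticleHole_conj_smul, partialParticleHole_conj_momentumNumber_up,
      partialParticleHole_conj_momentumNumber_down]
  have p2 : 𝓦₂ * (∑ k : TorusSite 2 L, ∑ σ : Fin 2, momentumNumber k σ) * 𝓦₂ᴴ =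
      ∑ k : TorusSite 2 L, (momentumNumber k 0 + (1 - momentumNumber (-k) 1)) := by
    rw [partialParticleHole_conj_sum]
    refine Finset.sum_congr rfl fun k _ => ?_
    rw [Fin.sum_univ_two, Matrix.mul_add, Matrix.add_mul, partialParticleHole_conj_momentumNumber_up,
      partialParticleHole_conj_momentumNumber_down]
  have p3 : 𝓦₂ * (∑ k : TorusSite 2 L, ((twistPairSymbol L φ k : ℝ) : ℂ) •
      (momentumAnnihilation k 0 * momentumAnnihilation (-k) 1)) * 𝓦₂ᴴ =
      ∑ k : TorusSite 2 L, ((twistPairSymbol L φ k : ℝ) : ℂ) •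
        (-(momentumCreation k 1 * momentumAnnihilation k 0)) := by
    rw [partialParticleHole_conj_sum]
    refine Finset.sum_congr rfl fun k _ => ?_
    rw [partialParticleHole_conj_smul, partialParticleHole_conj_pairAnnihilator]
  have p4 : 𝓦₂ * (∑ k : TorusSite 2 L, ((twistPairSymbol L φ k : ℝ) : ℂ) •
      (momentumAnnihilation k 0 * momentumAnnihilation (-k) 1))ᴴ * 𝓦₂ᴴ =
      ∑ k : TorusSite 2 L, ((twistPairSymbol L φ k : ℝ) : ℂ) •
        (-(momentumCreation k 0 * momentumAnnihilation k 1)) := by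
    have h3 := congrArg conjTranspose p3
    rw [conjTranspose_mul, conjTranspose_mul, conjTranspose_conjTranspose, ← Matrix.mul_assoc] at h3
    rw [h3, conjTranspose_sum]
    refine Finset.sum_congr rfl fun k _ => ?_
    rw [conjTranspose_smul, conjTranspose_neg, conjTranspose_mul, momentumCreation_conjTranspose,
      momentumAnnihilation_conjTranspose, Complex.star_def, Complex.conj_ofReal]
  -- distribute the conjugation
  rw [sourcedSpinTwistedHubbardTorus_zero_eq]
  rw [show ∀ A B C : Matrix (Finset (Orb (FermionTorus 2 L))) (Finset (Orb (FermionTorus 2 L))) ℂ,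
      𝓦₂ * (-A - (μ₀ : ℂ) • B - (h : ℂ) • C) * 𝓦₂ᴴ =
        -(𝓦₂ * A * 𝓦₂ᴴ) - (μ₀ : ℂ) • (𝓦₂ * B * 𝓦₂ᴴ) - (h : ℂ) • (𝓦₂ * C * 𝓦₂ᴴ) from fun A B C => by
      simp only [Matrix.mul_sub, Matrix.sub_mul, Matrix.mul_neg, Matrix.neg_mul, Matrix.mul_smul,
        Matrix.smul_mul]]
  rw [Matrix.mul_add, Matrix.add_mul, p1, p2, p3, p4]
  -- everything is now a sum over `k`; split off the `-k` parts and reindex them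
  have hsplit : ∀ k : TorusSite 2 L,
      -(((twistHopSymbol L φ k 0 : ℝ) : ℂ) • momentumNumber k 0 +
          ((twistHopSymbol L φ k 1 : ℝ) : ℂ) • (1 - momentumNumber (-k) 1)) -
        (μ₀ : ℂ) • (momentumNumber k 0 + (1 - momentumNumber (-k) 1)) -
        (h : ℂ) • (((twistPairSymbol L φ k : ℝ) : ℂ) • (-(momentumCreation k 1 * momentumAnnihilation k 0)) +
          ((twistPairSymbol L φ k : ℝ) : ℂ) • (-(momentumCreation k 0 * momentumAnnihilation k 1))) =
      ((-((twistHopSymbol L φ k 0 : ℝ) : ℂ) - μ₀) • momentumNumber k 0 +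
        ((h * twistPairSymbol L φ k : ℝ) : ℂ) • (momentumCreation k 1 * momentumAnnihilation k 0 +
          momentumCreation k 0 * momentumAnnihilation k 1)) +
      (((twistHopSymbol L φ (-(-k)) 1 : ℝ) : ℂ) + μ₀) • (momentumNumber (-k) 1 - 1) := by
    intro k
    rw [neg_neg]
    push_cast
    module
  have hsum : ∀ (f g : TorusSite 2 L → Matrix (Finset (Orb (FermionTorus 2 L)))
      (Finset (Orb (FermionTorus 2 L))) ℂ),
      ∑ k, (f k + g (-k)) = ∑ k, (f k + g k) := by
    intro f g
    rw [Finset.sum_add_distrib, Finset.sum_add_distrib, sum_neg_index]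
  rw [← Finset.sum_add_distrib, Finset.smul_sum, Finset.smul_sum, ← Finset.sum_neg_distrib,
    ← Finset.sum_sub_distrib, ← Finset.sum_sub_distrib]
  simp only [hsplit]
  rw [hsum (fun k => (-((twistHopSymbol L φ k 0 : ℝ) : ℂ) - μ₀) • momentumNumber k 0 +
        ((h * twistPairSymbol L φ k : ℝ) : ℂ) • (momentumCreation k 1 * momentumAnnihilation k 0 +
          momentumCreation k 0 * momentumAnnihilation k 1))
      (fun k => (((twistHopSymbol L φ (-k) 1 : ℝ) : ℂ) + μ₀) • (momentumNumber k 1 - 1))]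
  rw [Complex.ofReal_sum, Finset.sum_smul, ← Finset.sum_add_distrib]
  refine Finset.sum_congr rfl fun k _ => ?_
  rw [twistHopSymbol_neg_one, nambuQuad, twistXi_eq]
  push_cast
  module

end PH

end Summit.HubbardSuperconductivity.HubbardSuperconductivity.Theorems.NodalDiracTwist
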